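import Summits.BirchSwinnertonDyer.BirchSwinnertonDyer.Theses.SignedLowerHalves
import Summits.BirchSwinnertonDyer.BirchSwinnertonDyer.Theorems.KatoDescentTamePotSupersingularDefs
import Summits.BirchSwinnertonDyer.Rank1Residual.Supersingular.KobayashiMainConjecture
import Summits.BirchSwinnertonDyer.Rank1Residual.Supersingular.KobayashiMainConjectureX7FouquetWan
import Literature.NumberTheory.EllipticCurves.Fouquet2025.CongruenceTransportAnyReduction
import Literature.NumberTheory.EllipticCurves.BSDRootNumberSmallConductorProofs
import Literature.NumberTheory.EllipticCurves.Tamagawa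
import Literature.NumberTheory.EllipticCurves.AnalyticRank
import Literature.NumberTheory.EllipticCurves.KuriharaNumberKimModP
import HarnessLib

/-!
# Line `unitseed-fouquet` — crux `KobayashiLowerHalfLargeImage` (route SignedLowerHalves, rank 3; item
# stmt-BirchSwinnertonDyer-19001), crux-ideate round 1, k = 2

HONEST FRAMING (D-0152): this line feeds a CLASS route (rank-≤-1 residual classes; BSD_p assembled from
published theorems with the remainder TYPED); BSD is not proved by any of this; every stub is `sorry`ed and
the composition closes nothing until the stubs close.

LEVER («unit seed + published transport»). At a good supersingular prime `p` the residual representation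
`ρ̄ = E[p]` is irreducible on `G_{ℚ_p}`, so EVERY motivic point of Fouquet's universal deformation–Hecke
ring `T^Σ_{𝔪ρ̄}` is non-ordinary and no Skinner–Urban seed exists — which is why the cell's Fouquet facts
(A)/(B) (`Literature/…/Fouquet2025/CongruenceTransportAnyReduction.lean`) were only ever read with ORDINARY
seeds. But a seed need not come from an engine: at a motivic point with TRIVIAL Iwasawa cohomology
(`H²(ℤ[1/p], T_Iw) = 0` and Kato's class a generator) Kato's main conjecture holds by Kato 2004 + a FINITE
computation, and for an elliptic curve `E'` with good supersingular `p`, `a_p = 0`, analytic rank `0`,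
`ord_p(#Ш_an(E')) = 0` and `p ∤ ∏ c_ℓ(E')` this is Kato Thm 17.4 + Kobayashi 2003 (Thm 1.2/9.3 control,
interpolation `L^±_p(0) ∈ ℤ_pˣ·L(E',1)/Ω`, Thm 7.4) — exactly the seed Fouquet himself uses for
`y² = x³ − 7x − 6` at `p = 3` (Tunisian J. Math. 7 (2025) §4.2.1, corpus `paper:arxiv-2501.07105` p0029).
Fouquet's Thm 4.1 (1) ⇒ (2) (PUBLISHED; Ass. 2.9 = `Surj` + irreducibility at `p`; Ass. 3.4 on
`Σ ∖ Σ(ρ̄)`) then moves the zeta-isomorphism from `f_{E'}` to `f_E` inside `T^Σ_{𝔪ρ̄}`,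
`Σ = primes(N_E N_{E'}) ∪ {p}`, and Kobayashi Thm 7.4 converts it into BOTH signed main conjectures for
`E`. PER PAIR this is a closure FROM PRINT ALONE plus one certified finite search (find the seed); at
`p ∈ {3, 5}` the seeds can be elliptic curves because `X_E(p) ≅ ℙ¹` (Rubin–Silverberg 1995) supplies
infinitely many `E' ≡ E (mod p)`; at `p ≥ 7` congruent curves are sporadic (Mazur, `X_E(7)` has genus 3)
and the seed must be a level-raised NEWFORM with unit algebraic `L`-value — not typeable until the
algebraic part of `L(g,1)` for a `Γ₀(M)`-newform with Hecke field `K_g` is defined (definition request),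
hence a residue stub. CLASS-WIDE the open content is `stub_seedLe5`: «a seed exists» — a
non-vanishing-mod-`p` statement in the residual family, strictly weaker in shape than any main conjecture.

The line needs NO multiplicative prime of `E` of any kind, so it runs on the dossier's shapeless classes
D ∪ E (no engine in print there) as well as on B ∪ C; its own obstruction is Fouquet's Ass. 3.4 at the
unramified Tate primes of `E` and of `E'` (`Assumption34TateAt`: odd; Kummer clause at those `≡ 1 (mod p)`);
`E'` has no other primes outside `Σ(ρ̄)` (a bad prime with `ρ̄` unramified is multiplicative for `p ≥ 3`).

v1.1: seeds widened from UNIT seeds (`δ_1` unit) to KURIHARA seeds (`δ̃_n` unit for some `n`, Kim 2026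
Thm. 1.11 / KKS 2020 Thm. 1.1) — Fouquet Thm. 4.1 (1) needs the zeta isomorphism at ONE motivic point only.
Composition `KobayashiLowerHalfLargeImage_of`: case split `p ∈ {3,5}` / `p ≥ 7`, then on
`Assumption34TateAt p W`; kernel-checked, no sorry of its own; concludes the crux BY NAME.
-/

set_option autoImplicit false

noncomputable section

open scoped Classical MatrixGroups ModularForm

open CongruenceSubgroup WeierstrassCurve Literature.NumberTheory.EllipticCurves
  Literature.NumberTheory.EllipticCurves.ModularForms
  Literature.NumberTheory.EllipticCurves.Rank1Residual
  Literature.NumberTheory.EllipticCurves.Rank1Residual.Typed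
  Literature.NumberTheory.EllipticCurves.Kobayashi2003
  Literature.NumberTheory.EllipticCurves.Fouquet2025
  Summit.BirchSwinnertonDyer.Rank1Residual.Supersingular
  Summit.BirchSwinnertonDyer.BirchSwinnertonDyer.Theorems

namespace Summit.BirchSwinnertonDyer.BirchSwinnertonDyer.Cruxes.KobayashiLowerHalfLargeImage

namespace UnitSeedFouquet

/-- «`X` is a UNIT SEED for `(W, p)`» (posited object of the line; existence of a seed is `stub_seedLe5`):
an elliptic curve `X/ℚ` (globally minimal model) with `a_ℓ(X) ≡ a_ℓ(W) (mod p)` away from `p N_W N_X`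
(`Theorems.IsCongruentModP`, so `X[p] ≅ W[p] =: ρ̄` as `W[p]` is irreducible on X7), good supersingular at
`p` with `a_p(X) = 0`, analytic rank `0`, `ord_p(#Ш_an(X)) = 0`, `p ∤ ∏ c_ℓ(X)` (with `X(ℚ)[p] = 0`,
automatic from the onto image, these say `L(X,1)/Ω_X ∈ ℤ_(p)ˣ`: the Kato–Kobayashi «trivial main
conjecture» input, Fouquet §4.2.1), and Fouquet's Ass. 3.4 at the Tate primes of `X` where `ρ̄` is
unramified (`Assumption34TateAt p X`). NOTE (why no further clause): for `p ≥ 3` a bad prime `r` of `X`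
at which `ρ̄` is unramified is automatically MULTIPLICATIVE (a potentially-good inertia image injects into
`GL₂(𝔽_p)` since `ker(GL₂(ℤ_p) → GL₂(𝔽_p))` is torsion-free; a potentially-multiplicative one carries a
ramified quadratic character mod `p`), so the primes of `Σ ∖ Σ(ρ̄)`, `Σ = primes(p N_W N_X)`, are exactly
the unramified Tate primes of `W` and of `X`, the level there is Iwahori, and Ass. 3.4 reads: `r` odd;
`r ≢ ±1 (mod p)` case 2; `r ≡ −1 (mod p)` case 3(b) automatically (`γ = r^{±1} ≡ −1`, Iwahori points are
reducible at `r` — Fouquet's own `ℓ = 41`, `p = 3`); `r ≡ 1 (mod p)` case 5(b) = `ρ̄(Frob_r)` not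
diagonalizable = the Kummer clause of `Assumption34TateAt`. In particular the line is alive at `p = 3`
(no `≢ ±1` prime is ever needed). [cite: Fouquet2025EquivariantTNC, §4.2.1 (p. 29) and Ass. 3.4 (pp. 22–23)] -/
def IsUnitSeed (W : WeierstrassCurve ℚ) [W.IsElliptic] [W.IsGloballyMinimal] (p : ℕ) [Fact p.Prime]
    (X : WeierstrassCurve ℚ) [X.IsElliptic] [X.IsGloballyMinimal] : Prop :=
  IsCongruentModP p W X ∧ X.HasGoodReductionAtPrime p ∧ X.frobeniusTrace p = 0 ∧
  X.analyticRank = 0 ∧ (∃ q : ℚ, shaAn X = (q : ℂ) ∧ padicValRat p q = 0) ∧ ¬ p ∣ X.tamagawaProduct ∧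
  Assumption34TateAt p X

/-- A **Kurihara seed** (v1.1 sharpening): a congruent curve `X` at which Kato's main conjecture is KNOWN
from a unit Kurihara number `δ̃_n(X) ≢ 0 (mod p)` for SOME square-free Kolyvagin product `n` — C.-H. Kim
2026 Thm. 1.11 (1) ⇒ (3) at `p ≥ 5`, ANY reduction type (tree fact
`Kim2026.….thm111_etaEisensteinInclusion_of_kuriharaNumber_ne_zero` in the `η`-frame; hypotheses copied
from `Kim2022_exists_kuriharaNumber_modP_ne_zero`: good at `p`, `X(ℚ_p)[p] = 0` — automatic here since
`a_p(X) ≡ a_p(W) = 0`, non-anomalous —, `p ∤ ∏ c_ℓ(X)`, newform `f` with `p`-unit period transfer), or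
Kim–Kim–Sun 2020 Thm. 1.1 (ordinary and non-ordinary alike, their (Tam)). Fouquet's Thm. 4.1 (1) asks for
ONE motivic point of `T^Σ_{𝔪ρ̄}` carrying the zeta ISOMORPHISM, so such an `X` is a seed exactly like a unit
seed; unit seeds are the case `n = 1` (`kuriharaNumber_one`: `δ_1 = [0]⁺ = L(X,1)/Ω⁺`). Conjecturally
(Kurihara; Kim Thm. 1.11 (3) ⇒ (1)) EVERY congruent curve with `p ∤ Tam` is a Kurihara seed; numerically a
few modular symbols decide it (KKS «Algorithm» 1.6). `ρ̄_X ≅ ρ̄_W` is onto by `Surj W p`.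
[cite: Kim2022StructureSelmer, Thm. 1.11 (PDF p. 8), §1.2.2, §1.4.3] [cite: KimKimSun2020, Thm. 1.1, Rem. 1.5, §8.2.2]
[cite: Fouquet2025EquivariantTNC, Thm. 4.1 (1) ⇒ (2)] -/
def IsKuriharaSeed (W : WeierstrassCurve ℚ) [W.IsElliptic] [W.IsGloballyMinimal] (p : ℕ) [Fact p.Prime]
    (X : WeierstrassCurve ℚ) [X.IsElliptic] [X.IsGloballyMinimal] : Prop :=
  IsCongruentModP p W X ∧ X.HasGoodReductionAtPrime p ∧
  (∀ P : (X.baseChange ℚ_[p]).toAffine.Point, (p : ℤ) • P = 0 → P = 0) ∧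
  ¬ p ∣ X.tamagawaProduct ∧ Assumption34TateAt p X ∧
  ∃ (N : ℕ) (_ : NeZero N) (f : CuspForm (Gamma0 N) 2), IsNewformOf X f ∧
    (∃ u : ℚ, ‖(u : ℚ_[p])‖ = 1 ∧ X.realPeriodRat = u * plusPeriod f) ∧
    ∃ (n : ℕ) (_ : NeZero n), Kato.IsKolyvaginProduct X p 1 n ∧
      ∃ ψ : (ℓ : ℕ) → (ZMod ℓ)ˣ →* Multiplicative (ZMod p),
        (∀ ℓ ∈ n.primeFactors, Function.Surjective (ψ ℓ)) ∧ kuriharaNumber f p n ψ ≠ 0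

/-- A **seed** of the line: a unit seed (any `p`; Kato 17.4 / Kurihara 2002 / Kobayashi Thm. 1.2 give the
zeta isomorphism at `X`), or, at `p ≥ 5`, a Kurihara seed (Kim 2026 Thm. 1.11). -/
def IsSeed (W : WeierstrassCurve ℚ) [W.IsElliptic] [W.IsGloballyMinimal] (p : ℕ) [Fact p.Prime]
    (X : WeierstrassCurve ℚ) [X.IsElliptic] [X.IsGloballyMinimal] : Prop :=
  IsUnitSeed W p X ∨ (5 ≤ p ∧ IsKuriharaSeed W p X)

/-- stub (A SEED EXISTS at `p ∈ {3, 5}` — the class-wide open content of the line; per pair a finite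
certified search): at an X7 pair with `p ∈ {3,5}`, `a_p = 0`, `ρ̄_{W,p}` onto, some `E' ≡ E (mod p)` is a
seed (`IsSeed`: a unit seed, or at `p = 5` a Kurihara seed — conjecturally every congruent curve with
`5 ∤ ∏ c_ℓ` and Ass. 3.4, so at `p = 5` the stub is essentially «`X_E(5)(ℚ)` contains a curve good at 5 with
`5 ∤ Tam` and Fouquet-eligible Tate primes» plus Kurihara's non-vanishing for ONE member). Why plausibly true: `X_E(p) ≅ ℙ¹_ℚ` for `p = 3, 5` (Rubin–Silverberg 1995: explicit families
`E_t`, `t ∈ ℚ`, with `E_t[p] ≅ E[p]` symplectically), root number `+1` and `ord_p(L(E_t,1)/Ω) = 0` are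
each met on a positive proportion heuristically; the new bad primes `r` of `E_t` are level-raising primes
(`a_r(E) ≡ ±(r+1)`), automatically multiplicative, and Ass. 3.4 there asks only `r` odd and, when
`r ≡ 1 (mod p)`, `ρ̄(Frob_r)` non-semisimple (positive density by Chebotarev given `Surj`);
Fouquet finds such seeds «by inspection» (§4.2). OPEN as a class statement (a non-vanishing-mod-`p`
statement for the family `X_E(p)`); decidable per pair. Size L.
[cite: RubinSilverberg1995, Thm. 4.1 / §3 (families mod 3 and mod 5)]
[cite: Fouquet2025EquivariantTNC, §4.2 (pp. 28–30)] -/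
theorem stub_seedLe5 : ∀ (W : WeierstrassCurve ℚ) [W.IsElliptic] [W.IsGloballyMinimal] (p : ℕ)
    [Fact p.Prime], (p = 3 ∨ p = 5) → ClassX7 W p → W.frobeniusTrace p = 0 → Surj W p →
    Assumption34TateAt p W →
    ∃ (X : WeierstrassCurve ℚ) (_ : X.IsElliptic) (_ : X.IsGloballyMinimal), IsSeed W p X := by
  sorry

/-- stub (SEED TRANSPORT — published chain, to be TYPED as Literature facts and assembled): at an X7 pair
with `p ≠ 2`, `a_p = 0`, `ρ̄_{W,p}` onto and Fouquet's Ass. 3.4 at the unramified Tate primes of `W`, a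
seed `X` gives Kobayashi's main conjecture for `W` for BOTH signs. In print: (unit seed) Kato 2004
Thm 17.4 + Kobayashi 2003 Thm 1.2 / §9 control + (3.4)–(3.6) ⇒ `X^±(X/ℚ_∞) = 0` and `L^±_p(X) ∈ Λˣ`,
so both signed main conjectures hold for `X`, whence (Kobayashi Thm 7.4) Kato's main conjecture =
zeta-isomorphism for `f_X`; (Kurihara seed, `p ≥ 5`) Kim 2026 Thm. 1.11 (1) ⇒ (3): `δ̃_n(X) ≠ 0` ⇒ Kato's
Kolyvagin system of `X` is `Λ`-primitive ⇒ Kato's main conjecture for `X` (Mazur–Rubin 5.3.10); (transport) Fouquet 2025 Thm 4.1 (1) ⇒ (2) in `T^Σ_{𝔪ρ̄}`,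
`Σ = primes(N_W N_X) ∪ {p}`: Ass. 2.9 from `Surj` (and `ρ̄|G_{ℚ_p}` irreducible), Ass. 3.4 on
`Σ ∖ Σ(ρ̄)` = the unramified Tate primes of `W` and `X` (see `IsUnitSeed`) from the two `Assumption34TateAt`
clauses; (target) the zeta-isomorphism
for `f_W` is Kato's Conj. 12.10 for `W`, and Kobayashi Thm 7.4 at `a_p(W) = 0` gives both signs. Every
ingredient is PUBLISHED; size L (three Literature facts + glue). The `¬ HasCM` binder of the crux is not
needed (onto image). [cite: Fouquet2025EquivariantTNC, Thm. 4.1, Cor. 4.2, Ass. 2.9, Ass. 3.4, §4.2.1]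
[cite: Kobayashi2003, Thm. 1.2, Thm. 7.4 (p. 13), (3.4)–(3.6)] [cite: Kato2004, Thm. 17.4] -/
theorem stub_seedTransport : ∀ (W : WeierstrassCurve ℚ) [W.IsElliptic] [W.IsGloballyMinimal] (p : ℕ)
    [Fact p.Prime], p ≠ 2 → ClassX7 W p → W.frobeniusTrace p = 0 → Surj W p →
    Assumption34TateAt p W →
    (∃ (X : WeierstrassCurve ℚ) (_ : X.IsElliptic) (_ : X.IsGloballyMinimal), IsSeed W p X) →
    ∀ ε : ℤˣ, KobayashiMainConjecture W p ε := by
  sorry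

/-- stub (RESIDUE `p ≥ 7`): the crux at `p ≥ 7` for Fouquet-eligible `W`. Here congruent CURVES are
sporadic (`X_E(p)` has genus `≥ 3`), and the unit seed must be a rank-`0` NEWFORM `g ≡ f_E (mod 𝔭)` with
`ord_𝔭(L(g,1)/Ω⁺_g) = 0` (canonical period) — e.g. a level-raised form (Ribet 1984 / Diamond–Taylor 1994,
Chebotarev via `Surj`) that is NON-SPLIT multiplicative at the raised prime `q` (`a_q(g) = −1`, forced by
choosing `a_q(E) ≡ −(q+1) (mod p)`): then the `𝔭`-part of the component group at `q`, although non-trivial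
(level raising), is invisible over `ℚ` and over the cyclotomic tower (residue degrees at `q` are `p`-powers,
odd, so `q` stays non-split), so a unit canonical `L`-value is possible and Kato's argument gives
`H²(ℤ[1/p], T(g)_Iw) = 0` exactly as for curves. Same lever; NOT typeable until the algebraic part of
`L(g,1)` over the Hecke field `K_g` is defined (definition request D1 of the card). WARNING recorded in
the card: an ENGINE seed (FW21 Thm 7.32 / Wan U(3,1) at a level-raised `g` over an auxiliary `K` with `q`
non-split) is NOT a substitute — for residually-unramified `q` the anticyclotomic restriction carries
`μ ≥ ord_p(Tamagawa exponent at q) ≥ 1`, Hsieh's `μ = 0` step of FW 7.32 is unavailable, and the engine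
yields Kato's IMC for `g` only up to cyclotomic-pullback primes, which the Nakayama transport cannot use
(this is the content of FW Thm 5.1 (H3) / Fouquet Cor. 1.8 (1)). -/
theorem stub_pGe7 : ∀ (W : WeierstrassCurve ℚ) [W.IsElliptic] [W.IsGloballyMinimal] (p : ℕ)
    [Fact p.Prime], p ≠ 2 → ¬ (p = 3 ∨ p = 5) → ClassX7 W p → ¬ W.HasCM → W.frobeniusTrace p = 0 →
    Surj W p → Assumption34TateAt p W →
    ∃ ε : ℤˣ, KobayashiLowerDivisibility W p ε := by
  sorry

/-- stub (RESIDUE off Fouquet's Ass. 3.4): the crux at curves with an unramified Tate prime equal to `2`,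
or `≡ 1 (mod p)` with the Kummer clause failing (`¬ Assumption34TateAt p W`). Fallback in print: residual
(`μ = 0`) transfer of signed `λ`-invariants from a seed (B. D. Kim 2009 Cor. 2.13 / Greenberg–Vatsal
style), `μ = 0` certified per pair. -/
theorem stub_tateIneligible : ∀ (W : WeierstrassCurve ℚ) [W.IsElliptic] [W.IsGloballyMinimal] (p : ℕ)
    [Fact p.Prime], p ≠ 2 → ClassX7 W p → ¬ W.HasCM → W.frobeniusTrace p = 0 → Surj W p →
    ¬ Assumption34TateAt p W →
    ∃ ε : ℤˣ, KobayashiLowerDivisibility W p ε := by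
  sorry

/-- composition = THE SKELETON: the crux BY NAME from exactly the four registered stubs. Kernel-checked,
no sorry of its own. -/
theorem KobayashiLowerHalfLargeImage_of :
    Summit.BirchSwinnertonDyer.BirchSwinnertonDyer.Theses.SignedLowerHalves.KobayashiLowerHalfLargeImage := by
  intro W _ _ p _ hp hX hcm hap hs
  by_cases hel : Assumption34TateAt p W
  · by_cases h35 : p = 3 ∨ p = 5
    · have hseed := stub_seedLe5 W p h35 hX hap hs hel
      exact ⟨1, kobayashiLowerDivisibility_of_mainConjecture
        (stub_seedTransport W p hp hX hap hs hel hseed 1)⟩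
    · exact stub_pGe7 W p hp h35 hX hcm hap hs hel
  · exact stub_tateIneligible W p hp hX hcm hap hs hel

end UnitSeedFouquet

end Summit.BirchSwinnertonDyer.BirchSwinnertonDyer.Cruxes.KobayashiLowerHalfLargeImage

end
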